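import Summits.KontsevichZagierPeriods.KontsevichZagierPeriods.Theorems.PlanarK0Injective.Negative.Kit

/-!
# `PlanarK0Injective` (stmt-KontsevichZagierPeriods-9847): negative side — IV. the Dehn form of the crux

Refuter `cdisprove` (gen 2, cycle 2). `planarK0Injective_iff_forall_invariant`: the crux holds iff every
additive invariant `KZ.FormalRep →+ A` that vanishes on the planar moves (planar instances of rules 1a
and 2) takes equal values on planar sets of equal area (`→`: kernels are subgroups;
`←`: the quotient map `FormalRep → FormalRep ⧸ planarGroup` is such an invariant). So a refutation of the
crux is EXACTLY a "curved Dehn invariant" (an additive invariant of planar ℚ-regions under curved scissors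
and ℚ-semialgebraic area-preserving injections, finer than area) — the shape every disproof attempt must
take, and the reason none of the point-set / junk / torsion attacks of the work file
`Cruxes/PlanarK0Injective/Disproof.lean` can succeed without one.
[Kontsevich–Zagier 2001, §1.2; Cresson–Viu-Sos 2022, Problem 2.1]
-/

noncomputable section

open MeasureTheory Set MvPolynomial
open Literature.NumberTheory.Transcendental Literature.ModelTheory.ExponentialFields

namespace Summit.KontsevichZagierPeriods.SymplecticScissors.PlanarK0InjectiveNegative

open Summit.KontsevichZagierPeriods.KontsevichZagierPeriods.Theses.SymplecticScissors (PlanarK0Injective)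

/-! ## §6 The Dehn form of the crux: invariants -/

/-- **DEHN FORM OF THE CRUX.** `PlanarK0Injective` holds iff every additive invariant of formal
combinations of representations that vanishes on the planar moves (planar instances of 1a and 2)
takes equal values on planar sets of equal area. (`→`: the kernel of such an invariant contains
`planarGroup`; `←`: the quotient map `FormalRep → FormalRep ⧸ planarGroup` is such an invariant.)
So a refutation IS a "curved Dehn invariant" and nothing else. [folklore] -/
theorem planarK0Injective_iff_forall_invariant :
    PlanarK0Injective ↔ ∀ (A : Type) [AddCommGroup A] (h : KZ.FormalRep →+ A),
      (∀ c ∈ (KZ.domainAddRel ∪ KZ.changeOfVariablesRel) ∩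
        (AddSubgroup.closure planarGens : Set KZ.FormalRep), h c = 0) →
      ∀ r r' : KZ.IntegralRep 2, (∀ p ∈ r.domain, r.integrand p = 1) →
        (∀ p ∈ r'.domain, r'.integrand p = 1) → r.value = r'.value → h (KZ.of r) = h (KZ.of r') := by
  constructor
  · intro hP A _ h hh r r' hr hr' hv
    have hmem := hP r r' hr hr' hv
    have hle : planarGroup ≤ h.ker := (AddSubgroup.closure_le _).mpr fun c hc => hh c hc
    have h0 := hle hmem
    rwa [AddMonoidHom.mem_ker, map_sub, sub_eq_zero] at h0
  · intro H r r' hr hr' hv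
    have h := H (KZ.FormalRep ⧸ planarGroup) (QuotientAddGroup.mk' planarGroup) (fun c hc => ?_)
      r r' hr hr' hv
    · rwa [← sub_eq_zero, ← map_sub, QuotientAddGroup.mk'_apply, QuotientAddGroup.eq_zero_iff] at h
    · rw [QuotientAddGroup.mk'_apply, QuotientAddGroup.eq_zero_iff]
      exact AddSubgroup.subset_closure hc

end Summit.KontsevichZagierPeriods.SymplecticScissors.PlanarK0InjectiveNegative
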